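import Literature.NumberTheory.EllipticCurves.BSDSelmerPConverseSerreProofs
import HarnessLib

/-!
# X11b at `p = 3` (team N8/O2), E-K8 · IMG3-GEN in the `Γ_K`-currency (1/2): the framed
# representation on `E[p^{k+1}]` reduces ONTO `GL₂(𝔽_p)` along ANY homomorphism `φ : G → Γ_F`
# with `ρ̄_{E,p} ∘ φ` onto — e.g. `φ = absGaloisRestrict ℚ K : Γ_K → Γ_ℚ` (cell `b2b-bsdres`,
# team `x11b3`, seat p2)

HONEST FRAMING (verbatim, cell `b2b-bsdres`, run/shared/lean/b2b/bsd-rank1-residual/): the goal of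
the cell is to DELETE the COMBINATION-SHAPED residual classes for ALL analytic-rank `≤ 1` curves
over `ℚ` — "full BSD formula for every rank `≤ 1` curve in class `C`" assembled STRICTLY from
published theorems — so that the rank-`≤ 1` remainder becomes exactly the CONSTRUCTION-SHAPED
classes, which are TYPED (missing-input Props), NOT attempted; this is not "finishing BSD".
Research route (team N8/O2: STEP L at `3 ‖ N`, LINE K); ELEMENTARY Galois-module algebra; nothing
booked; no label touched; X11b@3 stays OPEN (RESIDUAL-MAP §I O2). THEOREMS ONLY; no definition;
no named fact; no `sorry`.

## Why (LINE-K block 3 U2 over the QUADRATIC field `K`)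

The E-K8 files (`Three/ImageSpan`, `Three/MoritaDuality`, `Three/ImageGenerates`,
`Three/GaloisImageSpansEnd`, `Three/GaloisStableHomEqTop`) take `W.HasSurjectiveModNGaloisRep p`,
the surjectivity of `ρ̄_{E,p}` on the FULL absolute Galois group `Γ_F` of the base field of `W`.
McCallum §3 works over `K = ℚ(√−D)` with `E` defined over `ℚ`, and the team's S6 record
(`Three/ImageAtThreeField`, x11b3-p1) delivers the surjectivity of the RESTRICTED representation
`(galoisRepTorsion W 3).comp (absGaloisRestrict ℚ K) : Γ_K → Aut(E[3])`. This file is the one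
piece of frame bookkeeping needed to run E-K8 in that currency: the tree's
`exists_map_eq_of_hasSurjectiveModNGaloisRep` (`BSDSelmerPConverseSerreProofs`, the case
`φ = id`) with `Γ_F` replaced by any group `G` mapping to `Γ_F`.

* `WeierstrassCurve.exists_map_comp_eq_of_surjective_comp` — `W` elliptic over a field `F` with
  `(p : F) ≠ 0`, a frame `e : E[p^{k+1}] ≃+ (ℤ/p^{k+1})²` with matrix representation `ρ`
  (`e (σ P) = ρ(σ) · e P`), `φ : G →* Γ_F` with `ρ̄_{E,p} ∘ φ` onto `Aut(E[p])` ⟹ every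
  `t ∈ GL₂(𝔽_p)` is `ρ(φ g) mod p` for some `g ∈ G`.

Proof = the tree's, VERBATIM up to the last step (adapted from
`Literature.NumberTheory.EllipticCurves.exists_map_eq_of_hasSurjectiveModNGaloisRep`, bsd.S25
companion; credited there to Silverman *AEC* III.7 — `E[p] = p^k E[p^{k+1}]`): the injection
`g : 𝔽_p² → E[p]`, `v ↦ e⁻¹(p^k ṽ)`, is a bijection (`#E[p] = p²`) with
`σ • g(v) = g((ρ σ mod p) v)`; transport `t` to `Aut(E[p])` along `g` and lift it through
`ρ̄_{E,p} ∘ φ` (instead of `ρ̄_{E,p}`). Companion `Three/GaloisStableRestrict.lean` (2/2) runs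
E-K8's span / End-stability / U2-core conclusions in this currency.

What this file is NOT: no claim about any class; nothing booked.

References: J.-P. Serre, *Propriétés galoisiennes des points d'ordre fini des courbes elliptiques*,
Invent. Math. 15 (1972) §IV [Serre1972]; J. H. Silverman, *AEC* III.7 [SilvermanAEC2009];
W. G. McCallum, LMS LNS 153 (1991) §3 [McCallum1991]; team files `cells/x11b3/LINE-K.md` block 3.
-/

noncomputable section

open scoped Classical MatrixGroups

open Matrix Literature.NumberTheory.EllipticCurves

universe u

namespace WeierstrassCurve

/-- **Compatibility of the framed representation on `E[p^{k+1}]` with `E[p] ⊂ E[p^{k+1}]`, along a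
homomorphism `φ : G → Γ_F`.** Let `e : E[p^{k+1}] ≃ (ℤ/p^{k+1})²` be a frame with matrix
representation `ρ` (`e (σ P) = ρ(σ) · e P`). If `ρ̄_{E,p} ∘ φ : G → Aut E[p]` is onto, then every
`t ∈ GL₂(𝔽_p)` is the reduction modulo `p` of `ρ(φ g)` for some `g ∈ G`. (The case `φ = id` is
the tree's `exists_map_eq_of_hasSurjectiveModNGaloisRep`, whose proof this is, verbatim up to the
lifting step: `v ↦ e⁻¹(p^k ṽ)` is a `Γ_F`-equivariant bijection `𝔽_p² ≅ E[p]`.) Typical use: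
`F = ℚ`, `G = Γ_K`, `φ = absGaloisRestrict ℚ K` with the surjectivity from
`Three/ImageAtThreeField`. [folklore] -/
theorem exists_map_comp_eq_of_surjective_comp {F : Type u} [Field F]
    (W : WeierstrassCurve F) [W.IsElliptic] (p k : ℕ) [Fact p.Prime] (hpF : (p : F) ≠ 0)
    (e : geomTorsion W ((p ^ (k + 1) : ℕ) : ℤ) ≃+ (Fin 2 → ZMod (p ^ (k + 1))))
    (ρ : Field.absoluteGaloisGroup F →* GL (Fin 2) (ZMod (p ^ (k + 1))))
    (hρ : ∀ (σ : Field.absoluteGaloisGroup F) (P : geomTorsion W ((p ^ (k + 1) : ℕ) : ℤ)),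
      e (σ • P) = ((ρ σ : GL (Fin 2) (ZMod (p ^ (k + 1)))) :
        Matrix (Fin 2) (Fin 2) (ZMod (p ^ (k + 1)))) *ᵥ e P)
    {G : Type*} [Group G] (φ : G →* Field.absoluteGaloisGroup F)
    (hsurj : Function.Surjective ((galoisRepTorsion W (p : ℤ)).comp φ))
    (t : GL (Fin 2) (ZMod p)) :
    ∃ g : G,
      Matrix.GeneralLinearGroup.map (ZMod.castHom (dvd_pow_self p k.succ_ne_zero) (ZMod p))
        (ρ (φ g)) = t := by
  have hp : p.Prime := Fact.out
  haveI : NeZero (p ^ (k + 1)) := ⟨pow_ne_zero _ hp.ne_zero⟩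
  set R := ZMod (p ^ (k + 1)) with hR
  set red : R →+* ZMod p := ZMod.castHom (dvd_pow_self p k.succ_ne_zero) (ZMod p) with hred
  -- `θ : ℤ/p → ℤ/p^(k+1)`, `x ↦ p^k x̃`
  set f : ℤ →+ R := (AddMonoidHom.mulLeft ((p : R) ^ k)).comp (Int.castAddHom R) with hf
  have hf_apply : ∀ x : ℤ, f x = (p : R) ^ k * (x : R) := fun x ↦ rfl
  have hf0 : f (p : ℕ) = 0 := by
    rw [hf_apply, Int.cast_natCast, ← pow_succ,
      Literature.NumberTheory.GaloisRepresentations.Serre1968.natCast_pow_eq_zero]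
  set θ : ZMod p →+ R := ZMod.lift p ⟨f, hf0⟩ with hθ
  have hθred : ∀ b : R, θ (red b) = (p : R) ^ k * b := fun b ↦ by
    rw [hred, ZMod.castHom_apply, ZMod.cast_eq_val, ← Int.cast_natCast, hθ, ZMod.lift_coe]
    change f _ = _
    rw [hf_apply, Int.cast_natCast, ZMod.natCast_zmod_val]
  have hθmul : ∀ (a : R) (x : ZMod p), a * θ x = θ (red a * x) := fun a x ↦ by
    obtain ⟨b, rfl⟩ := ZMod.ringHom_surjective red x
    rw [← map_mul, hθred, hθred]
    ring
  have hθp : ∀ x : ZMod p, p • θ x = 0 := fun x ↦ by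
    obtain ⟨b, rfl⟩ := ZMod.ringHom_surjective red x
    rw [hθred, nsmul_eq_mul, ← mul_assoc, ← pow_succ',
      Literature.NumberTheory.GaloisRepresentations.Serre1968.natCast_pow_eq_zero, zero_mul]
  have hθinj : ∀ x : ZMod p, θ x = 0 → x = 0 := fun x hx ↦ by
    obtain ⟨b, rfl⟩ := ZMod.ringHom_surjective red x
    rw [hθred] at hx
    obtain ⟨b', rfl⟩ :=
      Literature.NumberTheory.GaloisRepresentations.Serre1968.exists_eq_mul_of_pow_mul_eq_zero k.lt_succ_self b hx
    rw [map_mul, map_natCast, ZMod.natCast_self, zero_mul]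
  -- the injection `g : 𝔽_p² → E[p]`, `v ↦ e⁻¹ (θ ∘ v)`
  set lift : (Fin 2 → ZMod p) → geomTorsion W ((p ^ (k + 1) : ℕ) : ℤ) :=
    fun v ↦ e.symm (fun i ↦ θ (v i)) with hlift
  have hlift_mem : ∀ v, ((lift v : geomTorsion W ((p ^ (k + 1) : ℕ) : ℤ)) : geomPoints W) ∈
      geomTorsion W (p : ℤ) := fun v ↦ by
    rw [AddSubgroup.torsionBy.nsmul_iff, ← AddSubmonoidClass.coe_nsmul, hlift, ← map_nsmul]
    have : p • (fun i ↦ θ (v i)) = 0 := funext fun i ↦ by rw [Pi.smul_apply, hθp, Pi.zero_apply]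
    rw [this, map_zero]
    rfl
  set g : (Fin 2 → ZMod p) →+ geomTorsion W (p : ℤ) :=
    { toFun := fun v ↦ ⟨_, hlift_mem v⟩
      map_zero' := by
        apply Subtype.ext
        change ((e.symm fun i ↦ θ ((0 : Fin 2 → ZMod p) i) :
          geomTorsion W ((p ^ (k + 1) : ℕ) : ℤ)) : geomPoints W) = 0
        have : (fun i ↦ θ ((0 : Fin 2 → ZMod p) i)) = 0 := funext fun i ↦ by
          rw [Pi.zero_apply, map_zero, Pi.zero_apply]
        rw [this, map_zero]
        rfl
      map_add' := fun v w ↦ by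
        apply Subtype.ext
        change ((e.symm fun i ↦ θ ((v + w) i) : geomTorsion W ((p ^ (k + 1) : ℕ) : ℤ)) :
            geomPoints W) =
          ((e.symm fun i ↦ θ (v i) : geomTorsion W ((p ^ (k + 1) : ℕ) : ℤ)) : geomPoints W) +
            ((e.symm fun i ↦ θ (w i) : geomTorsion W ((p ^ (k + 1) : ℕ) : ℤ)) : geomPoints W)
        have : (fun i ↦ θ ((v + w) i)) = (fun i ↦ θ (v i)) + fun i ↦ θ (w i) :=
          funext fun i ↦ by rw [Pi.add_apply, map_add, Pi.add_apply]
        rw [this, map_add, AddSubgroup.coe_add] } with hg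
  have hg_coe : ∀ v, ((g v : geomTorsion W (p : ℤ)) : geomPoints W) = (lift v : geomPoints W) :=
    fun v ↦ rfl
  have hginj : Function.Injective g := by
    refine (injective_iff_map_eq_zero g).mpr fun v hv ↦ ?_
    have h1 : ((lift v : geomTorsion W ((p ^ (k + 1) : ℕ) : ℤ)) : geomPoints W) = 0 := by
      rw [← hg_coe, hv]; rfl
    have h2 : lift v = 0 := by exact_mod_cast h1
    rw [hlift, ← map_zero e.symm] at h2
    have h3 := e.symm.injective h2
    funext i
    exact hθinj _ (congrFun h3 i)
  -- `g` is a bijection, `#E[p] = p²`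
  have hpF' : ((p : ℕ) : AlgebraicClosure F) ≠ 0 := fun h0 ↦ hpF <| by
    apply (algebraMap F (AlgebraicClosure F)).injective
    rw [map_natCast, map_zero, h0]
  have hcard1 : Nat.card (geomTorsion W (p : ℤ)) = p ^ 2 :=
    card_torsionPoints_eq_sq_holds W (AlgebraicClosure F) hpF'
  haveI : Finite (geomTorsion W (p : ℤ)) :=
    Nat.finite_of_card_ne_zero (by rw [hcard1]; exact pow_ne_zero _ hp.ne_zero)
  have hbij : Function.Bijective g := hginj.bijective_of_nat_card_le (by
    rw [hcard1, Nat.card_fun, Nat.card_zmod, Nat.card_eq_fintype_card, Fintype.card_fin])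
  set gE : (Fin 2 → ZMod p) ≃+ geomTorsion W (p : ℤ) := AddEquiv.ofBijective g hbij with hgE
  -- equivariance: `σ • g v = g ((ρ σ mod p) v)`
  have hequiv : ∀ (σ : Field.absoluteGaloisGroup F) (v : Fin 2 → ZMod p),
      σ • g v = g (((Matrix.GeneralLinearGroup.map red (ρ σ) : GL (Fin 2) (ZMod p)) :
        Matrix (Fin 2) (Fin 2) (ZMod p)) *ᵥ v) := by
    intro σ v
    apply Subtype.ext
    rw [AddSubgroup.torsionBy.coe_smul, hg_coe, hg_coe, ← AddSubgroup.torsionBy.coe_smul]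
    have h1 : σ • lift v = e.symm (((ρ σ : GL (Fin 2) R) : Matrix (Fin 2) (Fin 2) R) *ᵥ
        fun i ↦ θ (v i)) := by
      have := congrArg e.symm (hρ σ (lift v))
      rwa [e.symm_apply_apply, hlift, e.apply_symm_apply] at this
    have h2 : (((ρ σ : GL (Fin 2) R) : Matrix (Fin 2) (Fin 2) R) *ᵥ fun i ↦ θ (v i)) =
        fun i ↦ θ ((((Matrix.GeneralLinearGroup.map red (ρ σ) : GL (Fin 2) (ZMod p)) :
          Matrix (Fin 2) (Fin 2) (ZMod p)) *ᵥ v) i) := by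
      have hmap : ∀ i j, ((Matrix.GeneralLinearGroup.map red (ρ σ) : GL (Fin 2) (ZMod p)) :
          Matrix (Fin 2) (Fin 2) (ZMod p)) i j = red (((ρ σ : GL (Fin 2) R) :
            Matrix (Fin 2) (Fin 2) R) i j) := fun i j ↦ rfl
      funext i
      simp only [Matrix.mulVec, dotProduct, Fin.sum_univ_two, map_add, hmap, ← hθmul]
    rw [h1, h2]
  -- transport `t` to an automorphism of `E[p]` and lift it THROUGH `φ`
  set tE : (Fin 2 → ZMod p) ≃+ (Fin 2 → ZMod p) :=
    { toFun := fun v ↦ (t : Matrix (Fin 2) (Fin 2) (ZMod p)) *ᵥ v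
      invFun := fun v ↦ ((t⁻¹ : GL (Fin 2) (ZMod p)) : Matrix (Fin 2) (Fin 2) (ZMod p)) *ᵥ v
      left_inv := fun v ↦ by
        change ((t⁻¹ : GL (Fin 2) (ZMod p)) : Matrix (Fin 2) (Fin 2) (ZMod p)) *ᵥ
          ((t : Matrix (Fin 2) (Fin 2) (ZMod p)) *ᵥ v) = v
        rw [Matrix.mulVec_mulVec, ← Matrix.GeneralLinearGroup.coe_mul, inv_mul_cancel,
          Matrix.GeneralLinearGroup.coe_one, Matrix.one_mulVec]
      right_inv := fun v ↦ by
        change (t : Matrix (Fin 2) (Fin 2) (ZMod p)) *ᵥ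
          (((t⁻¹ : GL (Fin 2) (ZMod p)) : Matrix (Fin 2) (Fin 2) (ZMod p)) *ᵥ v) = v
        rw [Matrix.mulVec_mulVec, ← Matrix.GeneralLinearGroup.coe_mul, mul_inv_cancel,
          Matrix.GeneralLinearGroup.coe_one, Matrix.one_mulVec]
      map_add' := fun v w ↦ Matrix.mulVec_add _ _ _ } with htE
  set ft : geomTorsion W (p : ℤ) ≃+ geomTorsion W (p : ℤ) := (gE.symm.trans tE).trans gE with hft
  obtain ⟨g₀, hg₀⟩ := hsurj (Multiplicative.ofAdd ft)
  rw [MonoidHom.comp_apply] at hg₀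
  have hσP : ∀ P : geomTorsion W (p : ℤ), (φ g₀) • P = ft P := fun P ↦ by
    rw [← galoisRepTorsion_apply W p (φ g₀) P, hg₀]
    rfl
  refine ⟨g₀, Units.ext (Matrix.ext fun i j ↦ ?_)⟩
  have hv : ∀ v : Fin 2 → ZMod p,
      ((Matrix.GeneralLinearGroup.map red (ρ (φ g₀)) : GL (Fin 2) (ZMod p)) :
        Matrix (Fin 2) (Fin 2) (ZMod p)) *ᵥ v = (t : Matrix (Fin 2) (Fin 2) (ZMod p)) *ᵥ v := by
    intro v
    apply hginj
    rw [← hequiv, hσP, hft, AddEquiv.trans_apply, AddEquiv.trans_apply]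
    have hgv : g v = gE v := (AddEquiv.ofBijective_apply g hbij v).symm
    rw [hgv, AddEquiv.symm_apply_apply]
    rfl
  have := congrFun (hv (Pi.single j 1)) i
  rwa [Matrix.mulVec_single_one, Matrix.mulVec_single_one] at this

end WeierstrassCurve

end
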